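import Summits.Ventures.PercRepro.C026PFunMono
import Summits.Ventures.PercRepro.C026PFunStar
import Summits.Ventures.PercRepro.C026PFunStarArith

/-!
# THEOREM S (ii): CONJECTURE (P) holds on every star skeleton (p6, gen 16; mine-3 §27)

`(P_star) ≥ 0` for every `k`, every band probe and every band components (`pFun_star_nonneg`).
PROOF. By `K`-monotonicity (`pFun_nonneg_of_corner`) it suffices to treat the lower corners
`K = K_min(x)`.  There every pendant factor triple `(3 − x, 1 + n̄K, n̄K + x)` is an affine
interpolation `(1 − t)·T⁰ + t·T¹`, `t ∈ [0, 1]`, between two of the three TYPES `E₀ = (3, 1, 0)`,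
`HALF = (5/2, 1, 1/2)`, `BARE = (2, 2, 2)` (`vertex_factors_eq`); expanding the three products of the
closed form `pFun_star_eq` in the tensor basis (`prod_affine_eq_sum`) writes `(P)` as a convex
combination over the subsets `T ⊆ ι` of the values at vertex-type assignments, and each of those is
`starTypeValue n j m Z K_min(Z) ≥ 0` (`C026PFunStarArith`).
-/

namespace PercRepro

namespace MultiGraph

open Finset

/-! ### The three vertex types and the affine interpolation at a corner -/

/-- The `a`-factor `3 − x` of the three types `E₀`, `HALF`, `BARE`. -/
noncomputable def aT : Fin 3 → ℝ := ![3, 5 / 2, 2]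

/-- The `b`-factor `1 + n̄K` of the three types. -/
def bT : Fin 3 → ℝ := ![1, 1, 2]

/-- The `c`-factor `n̄K + x` of the three types. -/
noncomputable def cT : Fin 3 → ℝ := ![0, 1 / 2, 2]

/-- The lower type of a pendant cell `x`: `E₀` on the zero piece, `HALF` on the tight curve. -/
noncomputable def pieceLo (x : ℝ) : Fin 3 := if x ≤ 1 / 2 then 0 else 1

/-- The upper type of a pendant cell `x`: `HALF` on the zero piece, `BARE` on the tight curve. -/
noncomputable def pieceHi (x : ℝ) : Fin 3 := if x ≤ 1 / 2 then 1 else 2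

/-- The interpolation parameter of a pendant cell `x` on its piece. -/
noncomputable def pieceT (x : ℝ) : ℝ := if x ≤ 1 / 2 then 2 * x else 2 * x - 1

/-- The interpolation parameter lies in `[0, 1]`. -/
theorem pieceT_mem {x : ℝ} (hx : 0 ≤ x ∧ x ≤ 1) : 0 ≤ pieceT x ∧ pieceT x ≤ 1 := by
  unfold pieceT
  split_ifs <;> constructor <;> linarith

/-- **The corner factors interpolate between two types**: for `x ∈ [0, 1]` and `K = K_min(x)`,
`(3 − x, 1 + (2 − x)K, (2 − x)K + x) = (1 − t)·T⁰ + t·T¹`. -/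
theorem vertex_factors_eq {x : ℝ} (hx : 0 ≤ x ∧ x ≤ 1) :
    3 - x = (1 - pieceT x) * aT (pieceLo x) + pieceT x * aT (pieceHi x) ∧
    1 + (2 - x) * kMin x = (1 - pieceT x) * bT (pieceLo x) + pieceT x * bT (pieceHi x) ∧
    (2 - x) * kMin x + x = (1 - pieceT x) * cT (pieceLo x) + pieceT x * cT (pieceHi x) := by
  unfold pieceT pieceLo pieceHi kMin aT bT cT
  by_cases h : x ≤ 1 / 2
  · have hk : max 0 ((2 * x - 1) / (2 - x)) = 0 := by
      rw [max_eq_left]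
      apply div_nonpos_of_nonpos_of_nonneg <;> linarith
    simp only [if_pos h, hk]
    refine ⟨?_, ?_, ?_⟩ <;> simp <;> ring
  · have h2 : (2 : ℝ) - x ≠ 0 := by linarith
    have hk : max 0 ((2 * x - 1) / (2 - x)) = (2 * x - 1) / (2 - x) := by
      rw [max_eq_right]
      apply div_nonneg <;> linarith
    have hmul : (2 - x) * ((2 * x - 1) / (2 - x)) = 2 * x - 1 := by
      rw [mul_div_cancel₀ _ h2]
    simp only [if_neg h, hk, hmul]
    refine ⟨?_, ?_, ?_⟩ <;> simp <;> ring

variable {ι : Type*} [Fintype ι] [DecidableEq ι]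

/-- **The tensor expansion of a product of affine interpolations**:
`∏_i ((1 − t_i)A_i + t_i B_i) = ∑_{T ⊆ ι} w_T · ∏_i (if i ∈ T then B_i else A_i)` with the weights
`w_T = ∏_{i ∈ T} t_i ∏_{i ∉ T} (1 − t_i)`. -/
theorem prod_affine_eq_sum (t A B : ι → ℝ) :
    ∏ i, ((1 - t i) * A i + t i * B i) =
      ∑ T : Finset ι, ((∏ i ∈ T, t i) * ∏ i ∈ Tᶜ, (1 - t i)) * ∏ i, (if i ∈ T then B i else A i) := by
  rw [Finset.prod_congr rfl fun i _ => show (1 - t i) * A i + t i * B i = t i * B i + (1 - t i) * A i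
    by ring]
  rw [Fintype.prod_add]
  refine Finset.sum_congr rfl fun T _ => ?_
  rw [Finset.prod_mul_distrib, Finset.prod_mul_distrib, Finset.prod_ite, Finset.filter_mem_eq_inter,
    Finset.univ_inter, Finset.filter_not, Finset.filter_mem_eq_inter, Finset.univ_inter,
    ← Finset.compl_eq_univ_sdiff]
  ring

/-- The tensor weights sum to one. -/
theorem sum_weights_eq_one (t : ι → ℝ) :
    ∑ T : Finset ι, ((∏ i ∈ T, t i) * ∏ i ∈ Tᶜ, (1 - t i)) = 1 := by
  have h := prod_affine_eq_sum t (fun _ => (1 : ℝ)) (fun _ => (1 : ℝ))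
  simp only [mul_one, ite_self, Finset.prod_const_one, sub_add_cancel] at h
  exact h.symm

/-- The tensor weights are nonnegative for `t ∈ [0, 1]`. -/
theorem weight_nonneg {t : ι → ℝ} (ht : ∀ i, 0 ≤ t i ∧ t i ≤ 1) (T : Finset ι) :
    0 ≤ (∏ i ∈ T, t i) * ∏ i ∈ Tᶜ, (1 - t i) :=
  mul_nonneg (Finset.prod_nonneg fun i _ => (ht i).1)
    (Finset.prod_nonneg fun i _ => by linarith [(ht i).2])

omit [DecidableEq ι] in
/-- A product over `ι` of a function of a `Fin 3`-valued type assignment, by fibres. -/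
theorem prod_fin3_comp (τ : ι → Fin 3) (f : Fin 3 → ℝ) :
    ∏ i, f (τ i) = f 0 ^ (univ.filter fun i => τ i = 0).card *
      f 1 ^ (univ.filter fun i => τ i = 1).card * f 2 ^ (univ.filter fun i => τ i = 2).card := by
  rw [← Finset.prod_fiberwise' univ τ f, Fin.prod_univ_three]
  simp only [Finset.prod_const]

omit [DecidableEq ι] in
/-- The fibre counts of a type assignment add up to the number of vertices. -/
theorem card_eq_sum_fin3 (τ : ι → Fin 3) :
    Fintype.card ι = (univ.filter fun i => τ i = 0).card + (univ.filter fun i => τ i = 1).card +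
      (univ.filter fun i => τ i = 2).card := by
  rw [← Finset.card_univ, Finset.card_eq_sum_card_fiberwise (t := (univ : Finset (Fin 3)))
    (fun i _ => Finset.mem_univ (τ i)), Fin.sum_univ_three]

omit [DecidableEq ι] in
/-- The value of the star's closed form at a type assignment is a `starTypeValue`. -/
theorem closedForm_type_eq (τ : ι → Fin 3) (Z KA : ℝ) :
    (∏ i, aT (τ i)) - 2 ^ (Fintype.card ι + 1) * Z + 2 * KA * ∏ i, bT (τ i) -
      KA * Z * ∏ i, cT (τ i) =
    starTypeValue (univ.filter fun i => τ i = 2).card (univ.filter fun i => τ i = 1).card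
      (univ.filter fun i => τ i = 0).card Z KA := by
  rw [prod_fin3_comp τ aT, prod_fin3_comp τ bT, prod_fin3_comp τ cT, card_eq_sum_fin3 τ]
  unfold starTypeValue
  simp only [aT, bT, cT, Matrix.cons_val_zero, Matrix.cons_val_one, Matrix.cons_val_two,
    Matrix.head_cons, Matrix.tail_cons]
  rw [show (univ.filter fun i => τ i = 0).card + (univ.filter fun i => τ i = 1).card +
      (univ.filter fun i => τ i = 2).card + 1 =
    (univ.filter fun i => τ i = 2).card + (univ.filter fun i => τ i = 1).card +
      (univ.filter fun i => τ i = 0).card + 1 by omega]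

/-! ### THEOREM S (ii) -/

/-- **The corner case of THEOREM S**: `(P_star) ≥ 0` when every cell sits at its lower corner. -/
theorem pFun_star_corner_nonneg (x : Option ι → ℝ) (hx : ∀ v, 0 ≤ x v ∧ x v ≤ 1) :
    0 ≤ (star ι).pFun none x (fun v => kMin (x v)) univ := by
  rw [pFun_star_eq]
  set t : ι → ℝ := fun i => pieceT (x (some i)) with ht_def
  set lo : ι → Fin 3 := fun i => pieceLo (x (some i)) with hlo_def
  set hi : ι → Fin 3 := fun i => pieceHi (x (some i)) with hhi_def
  have hfac := fun i => vertex_factors_eq (hx (some i))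
  have ha : ∏ i, (3 - x (some i)) = ∏ i, ((1 - t i) * aT (lo i) + t i * aT (hi i)) :=
    Finset.prod_congr rfl fun i _ => (hfac i).1
  have hb : ∏ i, (1 + (2 - x (some i)) * kMin (x (some i))) =
      ∏ i, ((1 - t i) * bT (lo i) + t i * bT (hi i)) :=
    Finset.prod_congr rfl fun i _ => (hfac i).2.1
  have hc : ∏ i, ((2 - x (some i)) * kMin (x (some i)) + x (some i)) =
      ∏ i, ((1 - t i) * cT (lo i) + t i * cT (hi i)) :=
    Finset.prod_congr rfl fun i _ => (hfac i).2.2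
  rw [ha, hb, hc, prod_affine_eq_sum, prod_affine_eq_sum, prod_affine_eq_sum]
  have ht : ∀ i, 0 ≤ t i ∧ t i ≤ 1 := fun i => pieceT_mem (hx (some i))
  -- the constant term as a sum over the same weights
  have hconst : (2 : ℝ) ^ (Fintype.card ι + 1) * x none =
      ∑ T : Finset ι, ((∏ i ∈ T, t i) * ∏ i ∈ Tᶜ, (1 - t i)) * (2 ^ (Fintype.card ι + 1) * x none) := by
    rw [← Finset.sum_mul, sum_weights_eq_one, one_mul]
  rw [hconst, Finset.mul_sum, Finset.mul_sum, ← Finset.sum_sub_distrib, ← Finset.sum_add_distrib,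
    ← Finset.sum_sub_distrib]
  refine Finset.sum_nonneg fun T _ => ?_
  have hw := weight_nonneg ht T
  have hτ := closedForm_type_eq (fun i => if i ∈ T then hi i else lo i) (x none) (kMin (x none))
  have hval := starTypeValue_nonneg ((univ.filter fun i => (if i ∈ T then hi i else lo i) = 2).card)
    ((univ.filter fun i => (if i ∈ T then hi i else lo i) = 1).card)
    ((univ.filter fun i => (if i ∈ T then hi i else lo i) = 0).card) (hx none)
  rw [← hτ] at hval
  have hfun : ∀ (f : Fin 3 → ℝ),
      ∏ i, (if i ∈ T then f (hi i) else f (lo i)) = ∏ i, f (if i ∈ T then hi i else lo i) :=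
    fun f => Finset.prod_congr rfl fun i _ => by split_ifs <;> rfl
  rw [hfun aT, hfun bT, hfun cT]
  calc (0 : ℝ) = ((∏ i ∈ T, t i) * ∏ i ∈ Tᶜ, (1 - t i)) * 0 := by ring
    _ ≤ ((∏ i ∈ T, t i) * ∏ i ∈ Tᶜ, (1 - t i)) *
        ((∏ i, aT (if i ∈ T then hi i else lo i)) - 2 ^ (Fintype.card ι + 1) * x none +
          2 * kMin (x none) * ∏ i, bT (if i ∈ T then hi i else lo i) -
          kMin (x none) * x none * ∏ i, cT (if i ∈ T then hi i else lo i)) :=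
        mul_le_mul_of_nonneg_left hval hw
    _ = _ := by ring

/-- **THEOREM S (ii) (mine-3 §27)**: CONJECTURE (P) holds on every star skeleton — `(P_star) ≥ 0`
for every `k`, every band probe `(Z_A, K_A)` and every band components `(x_i, K_i)`
(`x ∈ [0, 1]`, `K ≥ K_min(x)`). -/
theorem pFun_star_nonneg {x K : Option ι → ℝ} (hx : ∀ v, 0 ≤ x v ∧ x v ≤ 1)
    (hK : ∀ v, kMin (x v) ≤ K v) : 0 ≤ (star ι).pFun none x K univ :=
  pFun_nonneg_of_corner (fun x hx => pFun_star_corner_nonneg x hx) hx hK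

end MultiGraph

end PercRepro
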